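import Summits.CriticalPhenomena.CardyFormulaZ2.Theorems.CardySelfDualSegmentUniformBoxCrossingOfMonotoneChirality
import HarnessLib

/-!
# `UniformBoxCrossing` (stmt-CriticalPhenomena-5476) — split glue: the crux from the two halves of
endpoint domination

The registered kernel of line `Sketch` (`stub_endpointDomination`, lead c4) is a conjunction of two
one-endpoint comparisons with different anchors. The crux-strategist (s1, 2026-08-17,
`Cruxes/UniformBoxCrossing/STRATEGY-CENSUS.md`, `SPLIT-EndpointDomination.md`) prepared the split
`UniformBoxCrossing ⟸ EndpointDominationU ∧ EndpointDominationW` and registered the glue stub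
`uniformBoxCrossing_of_endpointDominationU_W` on the item; this file lands it (lead c5). Both
hypotheses are stated SELF-CONTAINED — with the route file's inlined coin model `prm` / `cfg`
(literally `cornerParam` / `cornerConfig`, so `M t = cornerPercolation t` by `cornerPercolation_def`)
and the diamond drawing `dia A B v = (v₀ - v₁) + (v₀ + v₁)·i - (A + B·i)` (literally
`TrackExchange.zDia v - (A + B·i)`, `col`/`hgtOf`) — so that the planner's
`route edit --split … --glue-by` can quote it verbatim:

* `hU` — ENDPOINT DOMINATION, u-half (anchored at the Smirnov endpoint `t = 0`, site percolation on
  the triangular lattice of corners): for every `t ∈ [0,1]` the `M_t`-probability of a u-crossing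
  (along `hgt = x₀ + x₁`) of the turned `m × 2m` box is at least its `M_0`-probability, eventually in
  `m`, at every integer position;
* `hW` — ENDPOINT DOMINATION, w-half (anchored at the bond-`ℤ²` endpoint `t = 1`): the
  `M_t`-probability of a w-crossing (along `col = x₀ - x₁`) of the turned `2m × m` box is at least its
  `M_1`-probability.

Conclusion: t-uniform box-crossing bounds for `cornerPercolation t` on `√2 ℤ²`, i.e. the crux
`Summit.CriticalPhenomena.CardyFormulaZ2.Theses.CardySelfDualSegment.UniformBoxCrossing` unfolded
(`uniformBoxCrossing_of_endpointDominationU_W_iff`). The proof is glue only: merge the two thresholds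
and apply the landed `uniformBoxCrossing_of_endpointDomination` (Theorems/…OfMonotoneChirality.lean:
endpoint inputs `stub_diagW_one`, `stub_diagU_zero_site`/`_dict`, chaining `stub_diagChain`, zig-zag
`stub_hardWay_of_diag`, Bollobás–Riordan tail `stub_glue → stub_upper → stub_render`, all landed).
Both halves are open (KERNEL-DOSSIER-c4/c5: a sign without a handle; the atomic per-(environment,
corner) strengthening is false on both sides, the summed / ψ / microcanonical forms hold exactly for
`m ≤ 3`).
-/

namespace Summit.CriticalPhenomena.CardyFormulaZ2.Cruxes.UniformBoxCrossing.NonSlantLine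

open MeasureTheory Complex Literature.Probability.Percolation Literature.Probability.LatticeModels
open Literature.Probability.Percolation.TrackExchange
open Summit.CriticalPhenomena.CardyFormulaZ2.Theses.CardySelfDualSegment

/-- **Split glue (registered stub `uniformBoxCrossing_of_endpointDominationU_W`).** The two halves of
endpoint domination for the turned 2:1 boxes — u-crossings of the `m × 2m` boxes never below their
`t = 0` (site-`𝕋`) value, w-crossings of the `2m × m` boxes never below their `t = 1` (bond-`ℤ²`) value,
both stated with the route's inlined coin model and the diamond drawing written out — give t-uniform
box-crossing bounds for the corner family `cornerPercolation t` drawn on `√2 ℤ²`, for every aspect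
ratio. Glue only: the hypotheses are definitionally the two conjuncts of endpoint domination
(`cornerPercolation_def`, `zDia`, `col`, `hgtOf`), merged at the larger threshold and fed to
`uniformBoxCrossing_of_endpointDomination`. -/
theorem uniformBoxCrossing_of_endpointDominationU_W (hU : let prm : unitInterval → Literature.Probability.LatticeModels.Site 2 × Fin 2 → unitInterval := fun t i => if i.2 = 0 then Literature.Probability.Percolation.half else Literature.Probability.Percolation.half * t; let cfg : Set (Literature.Probability.LatticeModels.Site 2 × Fin 2) → Literature.Probability.Percolation.BondConfig (Literature.Probability.LatticeModels.Site 2) := fun S => {e | ∃ v : Literature.Probability.LatticeModels.Site 2, (e = s(v, v + ![1, 0]) ∧ (v, (0 : Fin 2)) ∈ S) ∨ (e = s(v, v + ![0, 1]) ∧ ((v, (0 : Fin 2)) ∈ S ↔ (v, (1 : Fin 2)) ∉ S))}; let M : unitInterval → MeasureTheory.Measure (Literature.Probability.Percolation.BondConfig (Literature.Probability.LatticeModels.Site 2)) := fun t => (Literature.Probability.LatticeModels.prodBernoulli (prm t)).map cfg; let dia : ℤ → ℤ → Literature.Probability.LatticeModels.Site 2 → ℂ := fun A B v => ((v 0 -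 v 1 : ℤ) : ℂ) + ((v 0 + v 1 : ℤ) : ℂ) * Complex.I - ((A : ℂ) + (B : ℂ) * Complex.I); ∃ m₁ : ℕ, ∀ m : ℕ, m₁ ≤ m → ∀ (A B : ℤ) (t : unitInterval), (M 0).real (Literature.Probability.LatticeModels.embTBCrossing (dia A B) m (2 * m)) ≤ (M t).real (Literature.Probability.LatticeModels.embTBCrossing (dia A B) m (2 * m))) (hW : let prm : unitInterval → Literature.Probability.LatticeModels.Site 2 × Fin 2 → unitInterval := fun t i => if i.2 = 0 then Literature.Probability.Percolation.half else Literature.Probability.Percolation.half * t; let cfg : Set (Literature.Probability.LatticeModels.Site 2 × Fin 2) → Literature.Probability.Percolation.BondConfig (Literature.Probability.LatticeModels.Site 2) := fun S => {e | ∃ v : Literature.Probability.LatticeModels.Site 2, (e = s(v, v + ![1, 0]) ∧ (v, (0 : Fin 2)) ∈ S) ∨ (e = s(v, v + ![0, 1]) ∧ ((v, (0 : Fin 2)) ∈ S ↔ (v, (1 : Fin 2)) ∉ S))}; let M : unitInterval → MeasureTheory.Measure (Literature.Probability.Percolation.BondConfig (Literature.Probability.LatticeModels.Site 2)) := fun t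 => (Literature.Probability.LatticeModels.prodBernoulli (prm t)).map cfg; let dia : ℤ → ℤ → Literature.Probability.LatticeModels.Site 2 → ℂ := fun A B v => ((v 0 - v 1 : ℤ) : ℂ) + ((v 0 + v 1 : ℤ) : ℂ) * Complex.I - ((A : ℂ) + (B : ℂ) * Complex.I); ∃ m₁ : ℕ, ∀ m : ℕ, m₁ ≤ m → ∀ (A B : ℤ) (t : unitInterval), (M 1).real (Literature.Probability.LatticeModels.embRectCrossing (dia A B) (2 * m) m) ≤ (M t).real (Literature.Probability.LatticeModels.embRectCrossing (dia A B) (2 * m) m)) : ∀ ρ : ℝ, 0 < ρ → ∃ c > 0, ∃ n₀ : ℕ, ∀ t : unitInterval, Literature.Probability.LatticeModels.BoxCrossingBounds (Literature.Probability.Percolation.cornerPercolation t) Literature.Probability.LatticeModels.squareLatticeEmbedding.z ρ c n₀ := by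
  -- the hypotheses, read through the definitional identities `M t = cornerPercolation t`,
  -- `dia A B v = zDia v - (A + B·i)`
  have hU' : ∃ m₁ : ℕ, ∀ m : ℕ, m₁ ≤ m → ∀ (A B : ℤ) (t : unitInterval),
      (cornerPercolation 0).real (embTBCrossing (fun v => zDia v - ((A : ℂ) + (B : ℂ) * I)) m (2 * m)) ≤
        (cornerPercolation t).real (embTBCrossing (fun v => zDia v - ((A : ℂ) + (B : ℂ) * I)) m (2 * m)) :=
    hU
  have hW' : ∃ m₁ : ℕ, ∀ m : ℕ, m₁ ≤ m → ∀ (A B : ℤ) (t : unitInterval),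
      (cornerPercolation 1).real (embRectCrossing (fun v => zDia v - ((A : ℂ) + (B : ℂ) * I)) (2 * m) m) ≤
        (cornerPercolation t).real (embRectCrossing (fun v => zDia v - ((A : ℂ) + (B : ℂ) * I)) (2 * m) m) :=
    hW
  obtain ⟨mU, hmU⟩ := hU'
  obtain ⟨mW, hmW⟩ := hW'
  have hED : ∃ m₁ : ℕ, ∀ m : ℕ, m₁ ≤ m → ∀ (A B : ℤ) (t : unitInterval),
      (cornerPercolation 0).real (embTBCrossing (fun v => zDia v - ((A : ℂ) + (B : ℂ) * I)) m (2 * m)) ≤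
        (cornerPercolation t).real (embTBCrossing (fun v => zDia v - ((A : ℂ) + (B : ℂ) * I)) m (2 * m)) ∧
      (cornerPercolation 1).real (embRectCrossing (fun v => zDia v - ((A : ℂ) + (B : ℂ) * I)) (2 * m) m) ≤
        (cornerPercolation t).real (embRectCrossing (fun v => zDia v - ((A : ℂ) + (B : ℂ) * I)) (2 * m) m) :=
    ⟨max mU mW, fun m hm A B t =>
      ⟨hmU m (le_trans (le_max_left _ _) hm) A B t, hmW m (le_trans (le_max_right _ _) hm) A B t⟩⟩
  have h := uniformBoxCrossing_of_endpointDomination hED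
  exact h

/-- The conclusion of the split glue is literally the crux `UniformBoxCrossing` of route
`CardySelfDualSegment` (the route's inlined `prm`/`cfg` are `cornerParam`/`cornerConfig`, so its law
is `cornerPercolation t` by `cornerPercolation_def`). -/
theorem uniformBoxCrossing_iff_boxCrossingBounds_cornerPercolation :
    UniformBoxCrossing ↔ ∀ ρ : ℝ, 0 < ρ → ∃ c > 0, ∃ n₀ : ℕ, ∀ t : unitInterval,
      BoxCrossingBounds (cornerPercolation t) squareLatticeEmbedding.z ρ c n₀ :=
  Iff.rfl

end Summit.CriticalPhenomena.CardyFormulaZ2.Cruxes.UniformBoxCrossing.NonSlantLine
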